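import Summits.CriticalPhenomena.PercolationContinuityZ3.Theorems.PercNearOneGluingNoHeavyLowerTailIncStarTwoCutNearTransfer
import Summits.CriticalPhenomena.PercolationContinuityZ3.Theorems.PercNearOneGluingNoHeavyLowerTailIncStarTwoCutRealFX
import Mathlib.Tactic.LinearCombination
import HarnessLib

/-!
# Two-cuts with the root and one target on the root side (MODE B), XIV: THEOREM B⁺ from the far-side inequality (FX)

Support file for the Sahi programme (`--supports stmt-CriticalPhenomena-4575`, prover prim-sahi-p2 gen 27).  No definitions, no named facts,
no sorries; standard axioms.  Memo `…/FROM-prim-sahi-p2-gen27-BPLUS-GLUE-M8.md` §10, PROOF-E3 §37 (37j)–(37k).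

Part XI took the STAR row (N8) of the near lemma as hypothesis.  This part takes instead the FAR route of the gen-26 memo (R5): in `twoCut_Apart_lower`
(part XIII) the STAR row is only needed with the coefficient `π_xy`, and `S(u′) = STAR_N(a) − θu σ_u − θv σ_v`; so the two inequalities
(FX) `π_xy σ_u ≤ M_u = E₃({s↔u},{s↔b},{s↔c})`, `π_xy σ_v ≤ M_v` together with the near star `STAR_N(a) ≥ 0` close THEOREM B⁺:
`incStar_nonneg_of_twoCut_rootSideTarget_FX` (rows hN1–hN7 as hypotheses) and `incStar_nonneg_of_twoCut_rootSideTarget_of_FX` (rows discharged by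
part XII under non-null loner events; the near star supplied as `0 ≤ E₃` of the root-side events).  (FX) itself is OPEN but has exact degree-3 cell
certificates at every sampled class law and a q-uniform float certificate (kit j271903/j271905; memo §10).
-/

noncomputable section

namespace Summit.CriticalPhenomena.PercolationContinuityZ3.Theorems

namespace IncStarTwoCut

open MeasureTheory Set Literature.Probability.Percolation Literature.Probability.LatticeModels
open IncStarOneTargetSide
open scoped Classical

variable {n : ℕ}

set_option maxHeartbeats 1600000 in
/-- **THEOREM B⁺ from the far-side inequality (FX)** (conditional form).  Product Bernoulli bond percolation
`prodBernoulli w` on `Fin n`; a root side `R ∋ s`, separating vertices `u, v` (meant to lie outside `R`) with no positive pair from `R`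
to the outside of `R ∪ {u, v}`; the lone root-side target `a ∈ R ∪ {u, v}` and the targets `b, c ∉ R` outside.  Root-side numbers (pairs meeting `R` only,
`p ~_F q`): the class law `qX = P(s~u only)`, `qY = P(s~v only)`, `qW = P(s~u, s~v)`, the class vector of `A = {s ~_F a}`
(`a0, aX, aY, aW`), and the port-swap numbers `dX = P(a ~_F v, class X, ¬A)`, `dY = P(a ~_F u, class Y, ¬A)`; `θu·qY = dY`, `θv·qX = dX`
(`θ ≥ 0`; the memo's `θ_x = d_x/q_Y`, `θ_y = d_y/q_X`).  HYPOTHESES: the seven Harris/positivity rows hN1–hN7 of the near lemma for `u′ = u_A − θu·u_u − θv·u_v` (theorems of the near side,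
part XII), the near star `STAR_N(a; u, v) ≥ 0` in root-side numbers (inductively available), and the FAR-SIDE inequality (FX) at both ports:
`π_xy · σ_u ≤ E₃({s↔u},{s↔b},{s↔c})`, `π_xy · σ_v ≤ E₃({s↔v},{s↔b},{s↔c})`, `π_xy = P(T_b = u)P(T_c = v) + P(T_b = v)P(T_c = u)`,
`σ_u = (1 − x̄)(2w − x̄ȳ)` (memo gen 26 (R5); per-q and q-uniform LP certificates: gen-27 memo §10).  CONCLUSION: `0 ≤ E₃({s↔a},{s↔b},{s↔c})`.
Proof: (R1) at `t = a, u, v`; the A-part WITHOUT the STAR row (`twoCut_Apart_lower`: `min 0 (π_xy S(u′)) ≤ value(u′)`); in the branch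
`S(u′) < 0`, `S(u′) = STAR_N(a) − θu σ_u − θv σ_v` and (FX) give `E₃(a) ≥ π_xy STAR_N(a) + θu (M_u − π_xy σ_u) + θv (M_v − π_xy σ_v) ≥ 0`. [this work] -/
theorem incStar_nonneg_of_twoCut_rootSideTarget_FX (w : Sym2 (Fin n) → unitInterval) (R : Set (Fin n)) {s u v a b c : Fin n}
    (hs : s ∈ R) (ha : a ∈ R ∨ a = u ∨ a = v) (hb : b ∉ R) (hc : c ∉ R)
    (hw : ∀ x ∈ R, ∀ z, z ∉ R → z ≠ u → z ≠ v → w s(x, z) = 0)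
    {F : Set (Sym2 (Fin n))} (hF : F = {e : Sym2 (Fin n) | ∃ y ∈ R, y ∈ e})
    {Xu Xv Ba Va Ua : Set (BondConfig (Fin n))}
    (hXu : Xu = {ω | ω ∩ F ∈ (openConn s u : Set (BondConfig (Fin n)))})
    (hXv : Xv = {ω | ω ∩ F ∈ (openConn s v : Set (BondConfig (Fin n)))})
    (hBa : Ba = {ω | ω ∩ F ∈ (openConn s a : Set (BondConfig (Fin n)))})
    (hVa : Va = {ω | ω ∩ F ∈ (openConn v a : Set (BondConfig (Fin n)))})
    (hUa : Ua = {ω | ω ∩ F ∈ (openConn u a : Set (BondConfig (Fin n)))})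
    {qX qY qW a0 aX aY aW dX dY θu θv : ℝ}
    (hqX : qX = (prodBernoulli w).real (Xu \ Xv)) (hqY : qY = (prodBernoulli w).real (Xv \ Xu))
    (hqW : qW = (prodBernoulli w).real (Xu ∩ Xv))
    (ha0 : a0 = (prodBernoulli w).real (Ba ∩ (Xu ∪ Xv)ᶜ)) (haX : aX = (prodBernoulli w).real (Ba ∩ (Xu \ Xv)))
    (haY : aY = (prodBernoulli w).real (Ba ∩ (Xv \ Xu))) (haW : aW = (prodBernoulli w).real (Ba ∩ (Xu ∩ Xv)))
    (hdX : dX = (prodBernoulli w).real ((Ba ∪ Va) ∩ (Xu \ Xv)) - (prodBernoulli w).real (Ba ∩ (Xu \ Xv)))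
    (hdY : dY = (prodBernoulli w).real ((Ba ∪ Ua) ∩ (Xv \ Xu)) - (prodBernoulli w).real (Ba ∩ (Xv \ Xu)))
    (hθu0 : 0 ≤ θu) (hθv0 : 0 ≤ θv) (hθu : θu * qY = dY) (hθv : θv * qX = dX)
    -- the near lemma (N⁺): the cone rows for u′ = (aX − θu qX, aY − θv qY, aW − (θu+θv) qW ; α′)
    (hN1 : 0 ≤ aX - θu * qX) (hN2 : 0 ≤ aY - θv * qY) (hN3 : 0 ≤ aW - (θu + θv) * qW)
    (hN4 : (qX + qW) * (a0 + aX + aY + aW - θu * (qX + qW) - θv * (qY + qW)) ≤ (aX - θu * qX) + (aW - (θu + θv) * qW))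
    (hN5 : (qY + qW) * (a0 + aX + aY + aW - θu * (qX + qW) - θv * (qY + qW)) ≤ (aY - θv * qY) + (aW - (θu + θv) * qW))
    (hN6 : (qX + qW + (qY + qW) - qW) * (a0 + aX + aY + aW - θu * (qX + qW) - θv * (qY + qW))
      ≤ (aX - θu * qX) + (aY - θv * qY) + (aW - (θu + θv) * qW))
    (hN7 : qW * (a0 + aX + aY + aW - θu * (qX + qW) - θv * (qY + qW)) ≤ aW - (θu + θv) * qW)
    -- the near star at (a; u, v) on the root side (inductively available)
    (hNa : 0 ≤ 2 * aW - (aX + aW) * (qY + qW) - (aY + aW) * (qX + qW) - (qW - (qX + qW) * (qY + qW)) * (a0 + aX + aY + aW))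
    -- (FX) at the two ports: the moved-target star dominates π_xy · σ
    (hFX : ((prodBernoulli w).real (openConnIn Rᶜ u b \ openConnIn Rᶜ v b) * (prodBernoulli w).real (openConnIn Rᶜ v c \ openConnIn Rᶜ u c)
        + (prodBernoulli w).real (openConnIn Rᶜ v b \ openConnIn Rᶜ u b) * (prodBernoulli w).real (openConnIn Rᶜ u c \ openConnIn Rᶜ v c))
        * ((1 - (qX + qW)) * (2 * qW - (qX + qW) * (qY + qW))) ≤ sahiE3 (prodBernoulli w) (openConn s u) (openConn s b) (openConn s c))
    (hFY : ((prodBernoulli w).real (openConnIn Rᶜ u b \ openConnIn Rᶜ v b) * (prodBernoulli w).real (openConnIn Rᶜ v c \ openConnIn Rᶜ u c)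
        + (prodBernoulli w).real (openConnIn Rᶜ v b \ openConnIn Rᶜ u b) * (prodBernoulli w).real (openConnIn Rᶜ u c \ openConnIn Rᶜ v c))
        * ((1 - (qY + qW)) * (2 * qW - (qX + qW) * (qY + qW))) ≤ sahiE3 (prodBernoulli w) (openConn s v) (openConn s b) (openConn s c)) :
    0 ≤ sahiE3 (prodBernoulli w) (openConn s a) (openConn s b) (openConn s c) := by
  have hmeas : ∀ X : Set (BondConfig (Fin n)), MeasurableSet X := fun _ => MeasurableSet.of_discrete
  -- outside events and reals
  obtain ⟨Pb, hPb⟩ : ∃ S : Set (BondConfig (Fin n)), S = openConnIn Rᶜ u b := ⟨_, rfl⟩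
  obtain ⟨Qb, hQb⟩ : ∃ S : Set (BondConfig (Fin n)), S = openConnIn Rᶜ v b := ⟨_, rfl⟩
  obtain ⟨Pc, hPc⟩ : ∃ S : Set (BondConfig (Fin n)), S = openConnIn Rᶜ u c := ⟨_, rfl⟩
  obtain ⟨Qc, hQc⟩ : ∃ S : Set (BondConfig (Fin n)), S = openConnIn Rᶜ v c := ⟨_, rfl⟩
  obtain ⟨ζ, hζ⟩ : ∃ r : ℝ, r = (prodBernoulli w).real (openConnIn Rᶜ u v) := ⟨_, rfl⟩
  obtain ⟨bx, hbx⟩ : ∃ r : ℝ, r = (prodBernoulli w).real Pb := ⟨_, rfl⟩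
  obtain ⟨by_, hby⟩ : ∃ r : ℝ, r = (prodBernoulli w).real Qb := ⟨_, rfl⟩
  obtain ⟨bU, hbU⟩ : ∃ r : ℝ, r = (prodBernoulli w).real (Pb ∪ Qb) := ⟨_, rfl⟩
  obtain ⟨bN, hbN⟩ : ∃ r : ℝ, r = (prodBernoulli w).real (Pb ∩ Qb) := ⟨_, rfl⟩
  obtain ⟨cx, hcx⟩ : ∃ r : ℝ, r = (prodBernoulli w).real Pc := ⟨_, rfl⟩
  obtain ⟨cy, hcy⟩ : ∃ r : ℝ, r = (prodBernoulli w).real Qc := ⟨_, rfl⟩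
  obtain ⟨cU, hcU⟩ : ∃ r : ℝ, r = (prodBernoulli w).real (Pc ∪ Qc) := ⟨_, rfl⟩
  obtain ⟨cN, hcN⟩ : ∃ r : ℝ, r = (prodBernoulli w).real (Pc ∩ Qc) := ⟨_, rfl⟩
  obtain ⟨mxx, hmxx⟩ : ∃ r : ℝ, r = (prodBernoulli w).real (Pb ∩ Pc) := ⟨_, rfl⟩
  obtain ⟨myy, hmyy⟩ : ∃ r : ℝ, r = (prodBernoulli w).real (Qb ∩ Qc) := ⟨_, rfl⟩
  obtain ⟨mU, hmU⟩ : ∃ r : ℝ, r = (prodBernoulli w).real ((Pb ∪ Qb) ∩ (Pc ∪ Qc)) := ⟨_, rfl⟩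
  obtain ⟨mN, hmN⟩ : ∃ r : ℝ, r = (prodBernoulli w).real ((Pb ∩ Qb) ∩ (Pc ∩ Qc)) := ⟨_, rfl⟩
  obtain ⟨bpx, hbpx⟩ : ∃ r : ℝ, r = (prodBernoulli w).real (Pb \ Qb) := ⟨_, rfl⟩
  obtain ⟨bpy, hbpy⟩ : ∃ r : ℝ, r = (prodBernoulli w).real (Qb \ Pb) := ⟨_, rfl⟩
  obtain ⟨cpx, hcpx⟩ : ∃ r : ℝ, r = (prodBernoulli w).real (Pc \ Qc) := ⟨_, rfl⟩
  obtain ⟨cpy, hcpy⟩ : ∃ r : ℝ, r = (prodBernoulli w).real (Qc \ Pc) := ⟨_, rfl⟩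
  rw [← hPb, ← hQb, ← hPc, ← hQc, ← hbpx, ← hbpy, ← hcpx, ← hcpy] at hFX hFY
  -- outside facts
  have hbxs : bx = bpx + bN := by rw [hbx, hbpx, hbN]; exact real_sdiff_add_inter Pb Qb
  have hbys : by_ = bpy + bN := by rw [hby, hbpy, hbN, Set.inter_comm]; exact real_sdiff_add_inter Qb Pb
  have hbUs : bU = bpx + bpy + bN := by rw [hbU, hbpx, hbpy, hbN]; exact real_union_three Pb Qb
  have hcxs : cx = cpx + cN := by rw [hcx, hcpx, hcN]; exact real_sdiff_add_inter Pc Qc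
  have hcys : cy = cpy + cN := by rw [hcy, hcpy, hcN, Set.inter_comm]; exact real_sdiff_add_inter Qc Pc
  have hcUs : cU = cpx + cpy + cN := by rw [hcU, hcpx, hcpy, hcN]; exact real_union_three Pc Qc
  have upO : ∀ p q : Fin n, IsUpperSet (openConnIn Rᶜ p q : Set (BondConfig (Fin n))) := fun p q => isUpperSet_openConnIn Rᶜ p q
  have upPb : IsUpperSet Pb := by rw [hPb]; exact upO u b
  have upQb : IsUpperSet Qb := by rw [hQb]; exact upO v b
  have upPc : IsUpperSet Pc := by rw [hPc]; exact upO u c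
  have upQc : IsUpperSet Qc := by rw [hQc]; exact upO v c
  have hcovX : 0 ≤ mxx - bx * cx := by
    have h := prodBernoulli_harris w upPb upPc (hmeas _) (hmeas _)
    rw [hmxx, hbx, hcx]; linarith only [h]
  have hcovY : 0 ≤ myy - by_ * cy := by
    have h := prodBernoulli_harris w upQb upQc (hmeas _) (hmeas _)
    rw [hmyy, hby, hcy]; linarith only [h]
  have hcovU : 0 ≤ mU - bU * cU := by
    have h := prodBernoulli_harris w (upPb.union upQb) (upPc.union upQc) (hmeas _) (hmeas _)
    rw [hmU, hbU, hcU]; linarith only [h]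
  have hmxxU : mxx ≤ mU := by
    rw [hmxx, hmU]; exact measureReal_mono (Set.inter_subset_inter Set.subset_union_left Set.subset_union_left)
  have hmyyU : myy ≤ mU := by
    rw [hmyy, hmU]; exact measureReal_mono (Set.inter_subset_inter Set.subset_union_right Set.subset_union_right)
  have hbpx0 : 0 ≤ bpx := by rw [hbpx]; exact measureReal_nonneg
  have hbpy0 : 0 ≤ bpy := by rw [hbpy]; exact measureReal_nonneg
  have hbN0 : 0 ≤ bN := by rw [hbN]; exact measureReal_nonneg
  have hcpx0 : 0 ≤ cpx := by rw [hcpx]; exact measureReal_nonneg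
  have hcpy0 : 0 ≤ cpy := by rw [hcpy]; exact measureReal_nonneg
  have hcN0 : 0 ≤ cN := by rw [hcN]; exact measureReal_nonneg
  -- class-law facts
  have hqX0 : 0 ≤ qX := by rw [hqX]; exact measureReal_nonneg
  have hqY0 : 0 ≤ qY := by rw [hqY]; exact measureReal_nonneg
  have hqW0 : 0 ≤ qW := by rw [hqW]; exact measureReal_nonneg
  have ha00 : 0 ≤ a0 := by rw [ha0]; exact measureReal_nonneg
  have hxu : (prodBernoulli w).real Xu = qX + qW := by rw [hqX, hqW]; exact real_sdiff_add_inter Xu Xv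
  have hxv : (prodBernoulli w).real Xv = qY + qW := by rw [hqY, hqW, Set.inter_comm]; exact real_sdiff_add_inter Xv Xu
  have hxuv : (prodBernoulli w).real (Xu ∪ Xv) = qX + qY + qW := by rw [hqX, hqY, hqW]; exact real_union_three Xu Xv
  have upXu : IsUpperSet Xu := by rw [hXu]; exact isUpperSet_connF F s u
  have upXv : IsUpperSet Xv := by rw [hXv]; exact isUpperSet_connF F s v
  have hc' : (qX + qW) * (qY + qW) ≤ qW := by
    have h := prodBernoulli_harris w upXu upXv (hmeas _) (hmeas _)
    rw [hxu, hxv, ← hqW] at h; exact h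
  have hxb1 : qX + qW ≤ 1 := by rw [← hxu]; exact measureReal_le_one
  have hyb1 : qY + qW ≤ 1 := by rw [← hxv]; exact measureReal_le_one
  have hq0 : qX + qW + (qY + qW) - 1 ≤ qW := by
    have h : (prodBernoulli w).real (Xu ∪ Xv) ≤ 1 := measureReal_le_one
    rw [hxuv] at h; linarith only [h]
  -- (R1) at the target `a`
  have ea := twoCut_sahiE3_rootSide_eq w R hs ha hb hc hw hF hXu hXv hBa hVa hUa hPb hQb hPc hQc
    hζ hqX hqY hqW ha0 haX haY haW hdX hdY hbx hby hbU hbN hcx hcy hcU hcN hmxx hmyy hmU hmN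
  -- (R1) at the ports `u` and `v`
  obtain ⟨Vu, hVu⟩ : ∃ S : Set (BondConfig (Fin n)), S = {ω | ω ∩ F ∈ (openConn v u : Set (BondConfig (Fin n)))} := ⟨_, rfl⟩
  obtain ⟨Uu, hUu⟩ : ∃ S : Set (BondConfig (Fin n)), S = {ω | ω ∩ F ∈ (openConn u u : Set (BondConfig (Fin n)))} := ⟨_, rfl⟩
  obtain ⟨Vv, hVv⟩ : ∃ S : Set (BondConfig (Fin n)), S = {ω | ω ∩ F ∈ (openConn v v : Set (BondConfig (Fin n)))} := ⟨_, rfl⟩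
  obtain ⟨Uv, hUv⟩ : ∃ S : Set (BondConfig (Fin n)), S = {ω | ω ∩ F ∈ (openConn u v : Set (BondConfig (Fin n)))} := ⟨_, rfl⟩
  have hUu' : Uu = Set.univ := by
    rw [hUu]; exact Set.eq_univ_of_forall fun ω => (SimpleGraph.Reachable.refl u : (openGraph (ω ∩ F)).Reachable u u)
  have hVv' : Vv = Set.univ := by
    rw [hVv]; exact Set.eq_univ_of_forall fun ω => (SimpleGraph.Reachable.refl v : (openGraph (ω ∩ F)).Reachable v v)
  have su0 : (prodBernoulli w).real (Xu ∩ (Xu ∪ Xv)ᶜ) = 0 := by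
    rw [show Xu ∩ (Xu ∪ Xv)ᶜ = ∅ from Set.eq_empty_of_forall_notMem fun ω h => h.2 (Or.inl h.1), measureReal_empty]
  have suX : (prodBernoulli w).real (Xu ∩ (Xu \ Xv)) = qX := by rw [hqX, Set.inter_eq_self_of_subset_right Set.sdiff_subset]
  have suY : (prodBernoulli w).real (Xu ∩ (Xv \ Xu)) = 0 := by
    rw [show Xu ∩ (Xv \ Xu) = ∅ from Set.eq_empty_of_forall_notMem fun ω h => h.2.2 h.1, measureReal_empty]
  have suW : (prodBernoulli w).real (Xu ∩ (Xu ∩ Xv)) = qW := by rw [hqW, Set.inter_eq_self_of_subset_right Set.inter_subset_left]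
  have sudX : (prodBernoulli w).real ((Xu ∪ Vu) ∩ (Xu \ Xv)) - (prodBernoulli w).real (Xu ∩ (Xu \ Xv)) = 0 := by
    rw [show (Xu ∪ Vu) ∩ (Xu \ Xv) = Xu \ Xv from Set.inter_eq_self_of_subset_right (Set.sdiff_subset.trans Set.subset_union_left),
      Set.inter_eq_self_of_subset_right Set.sdiff_subset, sub_self]
  have sudY : (prodBernoulli w).real ((Xu ∪ Uu) ∩ (Xv \ Xu)) - (prodBernoulli w).real (Xu ∩ (Xv \ Xu)) = qY := by
    rw [hUu', Set.union_univ, Set.univ_inter, suY, sub_zero, hqY]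
  have sv0 : (prodBernoulli w).real (Xv ∩ (Xu ∪ Xv)ᶜ) = 0 := by
    rw [show Xv ∩ (Xu ∪ Xv)ᶜ = ∅ from Set.eq_empty_of_forall_notMem fun ω h => h.2 (Or.inr h.1), measureReal_empty]
  have svX : (prodBernoulli w).real (Xv ∩ (Xu \ Xv)) = 0 := by
    rw [show Xv ∩ (Xu \ Xv) = ∅ from Set.eq_empty_of_forall_notMem fun ω h => h.2.2 h.1, measureReal_empty]
  have svY : (prodBernoulli w).real (Xv ∩ (Xv \ Xu)) = qY := by rw [hqY, Set.inter_eq_self_of_subset_right Set.sdiff_subset]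
  have svW : (prodBernoulli w).real (Xv ∩ (Xu ∩ Xv)) = qW := by rw [hqW, Set.inter_eq_self_of_subset_right Set.inter_subset_right]
  have svdX : (prodBernoulli w).real ((Xv ∪ Vv) ∩ (Xu \ Xv)) - (prodBernoulli w).real (Xv ∩ (Xu \ Xv)) = qX := by
    rw [hVv', Set.union_univ, Set.univ_inter, svX, sub_zero, hqX]
  have svdY : (prodBernoulli w).real ((Xv ∪ Uv) ∩ (Xv \ Xu)) - (prodBernoulli w).real (Xv ∩ (Xv \ Xu)) = 0 := by
    rw [show (Xv ∪ Uv) ∩ (Xv \ Xu) = Xv \ Xu from Set.inter_eq_self_of_subset_right (Set.sdiff_subset.trans Set.subset_union_left),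
      Set.inter_eq_self_of_subset_right Set.sdiff_subset, sub_self]
  have eu := twoCut_sahiE3_rootSide_eq w R hs (Or.inr (Or.inl rfl)) hb hc hw hF hXu hXv hXu hVu hUu hPb hQb hPc hQc
    hζ hqX hqY hqW su0.symm suX.symm suY.symm suW.symm sudX.symm sudY.symm hbx hby hbU hbN hcx hcy hcU hcN hmxx hmyy hmU hmN
  have ev := twoCut_sahiE3_rootSide_eq w R hs (Or.inr (Or.inr rfl)) hb hc hw hF hXu hXv hXv hVv hUv hPb hQb hPc hQc
    hζ hqX hqY hqW sv0.symm svX.symm svY.symm svW.symm svdX.symm svdY.symm hbx hby hbU hbN hcx hcy hcU hcN hmxx hmyy hmU hmN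
  rw [eu] at hFX
  rw [ev] at hFY
  rw [ea]
  -- substitute the outside marginals by the type marginals
  subst hbxs hbys hbUs hcxs hcys hcUs
  -- the A-part real core for u′
  have hA := twoCut_Apart_lower (xb := qX + qW) (yb := qY + qW) (w := qW)
    (α := a0 + aX + aY + aW - θu * (qX + qW) - θv * (qY + qW))
    (aX := aX - θu * qX) (aY := aY - θv * qY) (aXY := aW - (θu + θv) * qW)
    (bpx := bpx) (bpy := bpy) (bn := bN) (cpx := cpx) (cpy := cpy) (cn := cN)
    (covX := mxx - (bpx + bN) * (cpx + cN)) (covY := myy - (bpy + bN) * (cpy + cN)) (covU := mU - (bpx + bpy + bN) * (cpx + cpy + cN))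
    hqW0 (by linarith only [hqX0]) (by linarith only [hqY0]) hxb1 hyb1 hc' hq0
    hN1 hN2 hN3 (by linarith only [ha00]) hN4 hN5 hN6 hN7 rfl
    hbpx0 hbpy0 hbN0 hcpx0 hcpy0 hcN0 hcovX hcovY hcovU (by linarith only [hmxxU]) (by linarith only [hmyyU])
    rfl rfl rfl rfl rfl rfl rfl rfl rfl
  -- assembly (B1) + Step 1, with the far route in the uncharged branch
  have hπ0 : 0 ≤ bpx * cpy + bpy * cpx := add_nonneg (mul_nonneg hbpx0 hcpy0) (mul_nonneg hbpy0 hcpx0)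
  have hσu : 0 ≤ (1 - (qX + qW)) * (2 * qW - (qX + qW) * (qY + qW)) := mul_nonneg (by linarith only [hxb1]) (by linarith only [hc', hqW0])
  have hσv : 0 ≤ (1 - (qY + qW)) * (2 * qW - (qX + qW) * (qY + qW)) := mul_nonneg (by linarith only [hyb1]) (by linarith only [hc', hqW0])
  have hMu0 := le_trans (mul_nonneg hπ0 hσu) hFX
  have hMv0 := le_trans (mul_nonneg hπ0 hσv) hFY
  subst hθu hθv
  rcases le_or_gt 0 ((bpx * cpy + bpy * cpx) * (2 * (aW - (θu + θv) * qW) - ((aX - θu * qX) + (aW - (θu + θv) * qW)) * (qY + qW)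
      - ((aY - θv * qY) + (aW - (θu + θv) * qW)) * (qX + qW)
      - (qW - (qX + qW) * (qY + qW)) * (a0 + aX + aY + aW - θu * (qX + qW) - θv * (qY + qW)))) with hpos | hneg
  · rw [min_eq_left hpos] at hA
    have hprod_u := mul_nonneg hθu0 hMu0
    have hprod_v := mul_nonneg hθv0 hMv0
    linear_combination hA + hprod_u + hprod_v
  · rw [min_eq_right (le_of_lt hneg)] at hA
    have hu2 := mul_le_mul_of_nonneg_left hFX hθu0
    have hv2 := mul_le_mul_of_nonneg_left hFY hθv0
    have hSa := mul_nonneg hπ0 hNa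
    linear_combination hA + hu2 + hv2 + hSa

/-- **THEOREM B⁺ ⟸ (FX)** (rows discharged).  Setting of part XI with `s, u, v` distinct and non-null loner/separation events on the root side; hypotheses:
the near star `0 ≤ E₃(Ba, Xu, Xv)` of the ROOT-SIDE events (an increasing star of the restricted weight — inductively available) and (FX) at the two ports.
[this work] -/
theorem incStar_nonneg_of_twoCut_rootSideTarget_of_FX (w : Sym2 (Fin n) → unitInterval) (R : Set (Fin n)) {s u v a b c : Fin n}
    (hs : s ∈ R) (ha : a ∈ R ∨ a = u ∨ a = v) (hb : b ∉ R) (hc : c ∉ R) (hus : u ≠ s) (hvs : v ≠ s) (huv : u ≠ v)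
    (hw : ∀ x ∈ R, ∀ z, z ∉ R → z ≠ u → z ≠ v → w s(x, z) = 0)
    {F : Set (Sym2 (Fin n))} (hF : F = {e : Sym2 (Fin n) | ∃ y ∈ R, y ∈ e})
    {Xu Xv Ba Va Ua : Set (BondConfig (Fin n))}
    (hXu : Xu = {ω | ω ∩ F ∈ (openConn s u : Set (BondConfig (Fin n)))})
    (hXv : Xv = {ω | ω ∩ F ∈ (openConn s v : Set (BondConfig (Fin n)))})
    (hBa : Ba = {ω | ω ∩ F ∈ (openConn s a : Set (BondConfig (Fin n)))})
    (hVa : Va = {ω | ω ∩ F ∈ (openConn v a : Set (BondConfig (Fin n)))})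
    (hUa : Ua = {ω | ω ∩ F ∈ (openConn u a : Set (BondConfig (Fin n)))})
    {qX qY qW a0 aX aY aW dX dY : ℝ}
    (hqX : qX = (prodBernoulli w).real (Xu \ Xv)) (hqY : qY = (prodBernoulli w).real (Xv \ Xu))
    (hqW : qW = (prodBernoulli w).real (Xu ∩ Xv))
    (ha0 : a0 = (prodBernoulli w).real (Ba ∩ (Xu ∪ Xv)ᶜ)) (haX : aX = (prodBernoulli w).real (Ba ∩ (Xu \ Xv)))
    (haY : aY = (prodBernoulli w).real (Ba ∩ (Xv \ Xu))) (haW : aW = (prodBernoulli w).real (Ba ∩ (Xu ∩ Xv)))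
    (hdX : dX = (prodBernoulli w).real ((Ba ∪ Va) ∩ (Xu \ Xv)) - (prodBernoulli w).real (Ba ∩ (Xu \ Xv)))
    (hdY : dY = (prodBernoulli w).real ((Ba ∪ Ua) ∩ (Xv \ Xu)) - (prodBernoulli w).real (Ba ∩ (Xv \ Xu)))
    (hDu : 0 < (prodBernoulli w).real {ω | ω ∩ F ∈ ((openConn u s)ᶜ ∩ (openConn u v)ᶜ : Set (BondConfig (Fin n)))})
    (hDv : 0 < (prodBernoulli w).real {ω | ω ∩ F ∈ ((openConn v s)ᶜ ∩ (openConn v u)ᶜ : Set (BondConfig (Fin n)))})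
    (hD0 : 0 < (prodBernoulli w).real {ω | ω ∩ F ∈ ((openConn s u)ᶜ ∩ (openConn s v)ᶜ ∩ (openConn u v)ᶜ : Set (BondConfig (Fin n)))})
    (hNa : 0 ≤ sahiE3 (prodBernoulli w) Ba Xu Xv)
    (hFX : ((prodBernoulli w).real (openConnIn Rᶜ u b \ openConnIn Rᶜ v b) * (prodBernoulli w).real (openConnIn Rᶜ v c \ openConnIn Rᶜ u c)
        + (prodBernoulli w).real (openConnIn Rᶜ v b \ openConnIn Rᶜ u b) * (prodBernoulli w).real (openConnIn Rᶜ u c \ openConnIn Rᶜ v c))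
        * ((1 - (qX + qW)) * (2 * qW - (qX + qW) * (qY + qW))) ≤ sahiE3 (prodBernoulli w) (openConn s u) (openConn s b) (openConn s c))
    (hFY : ((prodBernoulli w).real (openConnIn Rᶜ u b \ openConnIn Rᶜ v b) * (prodBernoulli w).real (openConnIn Rᶜ v c \ openConnIn Rᶜ u c)
        + (prodBernoulli w).real (openConnIn Rᶜ v b \ openConnIn Rᶜ u b) * (prodBernoulli w).real (openConnIn Rᶜ u c \ openConnIn Rᶜ v c))
        * ((1 - (qY + qW)) * (2 * qW - (qX + qW) * (qY + qW))) ≤ sahiE3 (prodBernoulli w) (openConn s v) (openConn s b) (openConn s c)) :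
    0 ≤ sahiE3 (prodBernoulli w) (openConn s a) (openConn s b) (openConn s c) := by
  obtain ⟨h0u, h0v, hθu, hθv, n1, n2, n3, n4, n5, n6, n7⟩ :=
    twoCut_near_rows w hus hvs huv F hXu hXv hBa hVa hUa hqX hqY hqW ha0 haX haY haW hdX hdY hDu hDv hD0
  -- the near star in numbers
  have hNa' : 0 ≤ 2 * aW - (aX + aW) * (qY + qW) - (aY + aW) * (qX + qW) - (qW - (qX + qW) * (qY + qW)) * (a0 + aX + aY + aW) := by
    have hmeas : ∀ X : Set (BondConfig (Fin n)), MeasurableSet X := fun _ => MeasurableSet.of_discrete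
    have xu : (prodBernoulli w).real Xu = qX + qW := by rw [hqX, hqW]; exact real_sdiff_add_inter Xu Xv
    have xv : (prodBernoulli w).real Xv = qY + qW := by rw [hqY, hqW, Set.inter_comm]; exact real_sdiff_add_inter Xv Xu
    have AX : (prodBernoulli w).real (Ba ∩ Xu) = aX + aW := by
      rw [haX, haW, ← Set.inter_sdiff_assoc, ← Set.inter_assoc]; exact real_sdiff_add_inter (Ba ∩ Xu) Xv
    have AY : (prodBernoulli w).real (Ba ∩ Xv) = aY + aW := by
      rw [haY, haW, ← Set.inter_sdiff_assoc, Set.inter_comm Xu Xv, ← Set.inter_assoc]; exact real_sdiff_add_inter (Ba ∩ Xv) Xu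
    have AU : (prodBernoulli w).real (Ba ∩ (Xu ∪ Xv)) = aX + aY + aW := by
      have h := measureReal_union_add_inter (μ := prodBernoulli w) (s := Ba ∩ Xu) (t := Ba ∩ Xv) (hmeas _)
      rw [← Set.inter_union_distrib_left, show Ba ∩ Xu ∩ (Ba ∩ Xv) = Ba ∩ (Xu ∩ Xv) by
        ext ω; simp only [Set.mem_inter_iff]; tauto, AX, AY, ← haW] at h
      linarith
    have AL : (prodBernoulli w).real Ba = a0 + aX + aY + aW := by
      have h := real_sdiff_add_inter (μ := prodBernoulli w) Ba (Xu ∪ Xv)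
      rw [AU, show Ba \ (Xu ∪ Xv) = Ba ∩ (Xu ∪ Xv)ᶜ from Set.sdiff_eq _ _, ← ha0] at h
      linarith
    rw [sahiE3_def, Set.inter_assoc, ← haW, AL, xu, xv, ← hqW, AY, AX] at hNa
    linarith only [hNa]
  exact incStar_nonneg_of_twoCut_rootSideTarget_FX w R hs ha hb hc hw hF hXu hXv hBa hVa hUa hqX hqY hqW ha0 haX haY haW hdX hdY
    h0u h0v hθu hθv n1 n2 n3 n4 n5 n6 n7 hNa' hFX hFY

end IncStarTwoCut

end Summit.CriticalPhenomena.PercolationContinuityZ3.Theorems
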